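import Mathlib.Algebra.Lie.Free
import Literature.Algebra.Lie.SurfaceLieAlgebra
import Literature.Algebra.Lie.FreeLieAlgebraGrading
import Summits.SmoothPoincare4.SmoothPoincare4.Theorems.CongruenceShadowsNilpotentShadowsStandardStubDTwoIndep
import Mathlib.Tactic.LinearCombination
import HarnessLib

/-!
# Helper `Coeff` for stub `stub_dTwoSpan` of line `saturated-torsor-descent`, crux
`CongruenceShadows.NilpotentShadowsStandard` (item stmt-SmoothPoincare4-14594)

Word-coefficient calculus for degree-`3` tuples `v : Fin n → L = FreeLieAlgebra ℤ (Fin n)` through the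
canonical Lie morphism `φ = toTensor ℤ (Fin n) : L → ℤ⟨X⟩ = ℤ[FreeMonoid (Fin n)]`
(`Literature/Algebra/Lie/FreeLieAlgebraGrading.lean`), on top of the sibling stub file
`…StubDTwoIndep` (`DTwoIndep.coeff_lie₃`: `φ⁅a,⁅b,c⁆⁆ = abc - acb - bca + cba`):
* `coeff_lie_of₄`: the coefficient of `φ⁅x_i, v⁆ = x_i φ(v) - φ(v) x_i` at a word `jpqr`;
  hence (`coeff_cyclic_of_sum_lie_eq_zero`) the kernel equation `∑ⱼ ⁅xⱼ, vⱼ⁆ = 0` says that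
  `H(j,p,q,r) := [pqr] φ(v j)` is invariant under the rotation `(j,p,q,r) ↦ (r,j,p,q)`;
* `wordGrade_three_le_span_lie₃`: `L₃` is spanned by the brackets `⁅a,⁅b,c⁆⁆` of letters, whence
  for `v ∈ L₃` the coefficients of `φ v` are palindromic (`coeff_rev_of_mem_three`) and have vanishing
  content sums (`coeff_perm_sum_of_mem_three`) — both are polynomial identities in indicators after
  `coeff_lie₃_prod` — and live on words of length `3` (`coeff_eq_zero_of_length_ne_three`);
* small algebra for the verification that the square/tree tuples lie in the kernel: the Jacobi
  consequence `four_term` and the bookkeeping lemmas `sum_lie_sum₂/₃/₄`, `lie_ite_zero`.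
Mathlib + `Literature` + the landed sibling only; no definitions, no named facts.
-/

-- the prescribed namespace `Summit.<P>.<Sub>.…` duplicates `SmoothPoincare4` (P = Sub)
set_option linter.dupNamespace false

namespace Summit.SmoothPoincare4.SmoothPoincare4.Theorems.NilpotentShadowsStandard.SaturatedTorsorDescent

open Literature.Algebra.Lie DTwoIndep

namespace DTwoSpan

variable {n : ℕ}

/-! ## The kernel equation, read at a word of length four -/

/-- Words of length four are equal iff letterwise equal. [folklore] -/
theorem of_mul₄_eq_iff (a b c d p q r s : Fin n) :
    FreeMonoid.of a * FreeMonoid.of b * FreeMonoid.of c * FreeMonoid.of d =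
      FreeMonoid.of p * FreeMonoid.of q * FreeMonoid.of r * FreeMonoid.of s ↔
        a = p ∧ b = q ∧ c = r ∧ d = s := by
  rw [← FreeMonoid.toList.apply_eq_iff_eq]
  simp [FreeMonoid.toList_mul, FreeMonoid.toList_of]

/-- **Coefficient of `φ⁅x_i, v⁆ = x_i·φ(v) - φ(v)·x_i` at the word `jpqr`.** [folklore] -/
theorem coeff_lie_of₄ (i : Fin n) (v : FreeLieAlgebra ℤ (Fin n)) (j p q r : Fin n) :
    (toTensor ℤ (Fin n) ⁅FreeLieAlgebra.of ℤ i, v⁆).coeff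
        (FreeMonoid.of j * FreeMonoid.of p * FreeMonoid.of q * FreeMonoid.of r) =
      (if i = j then (toTensor ℤ (Fin n) v).coeff (FreeMonoid.of p * FreeMonoid.of q * FreeMonoid.of r)
        else 0) -
      (if i = r then (toTensor ℤ (Fin n) v).coeff (FreeMonoid.of j * FreeMonoid.of p * FreeMonoid.of q)
        else 0) := by
  -- `simp only`, not `rw`: the commutator `LieRing` structure on `ℤ⟨X⟩` is not a global instance
  simp only [LieHom.map_lie, toTensor_of, LieRing.of_associative_ring_bracket, MonoidAlgebra.coeff_sub,
    Finsupp.sub_apply]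
  congr 1
  · split_ifs with h
    · subst h
      rw [show FreeMonoid.of i * FreeMonoid.of p * FreeMonoid.of q * FreeMonoid.of r =
          FreeMonoid.of i * (FreeMonoid.of p * FreeMonoid.of q * FreeMonoid.of r) by simp only [mul_assoc],
        MonoidAlgebra.coeff_single_mul_mul, one_mul]
    · refine MonoidAlgebra.coeff_single_mul_of_forall_mul_ne _ _ fun d hd => ?_
      obtain ⟨a, b, c, rfl⟩ : ∃ a b c, d = FreeMonoid.of a * FreeMonoid.of b * FreeMonoid.of c := by
        have hl := congrArg FreeMonoid.length hd
        simp only [FreeMonoid.length_mul, FreeMonoid.length_of] at hl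
        exact FreeMonoid.length_eq_three.1 (by omega)
      rw [← mul_assoc, ← mul_assoc, of_mul₄_eq_iff] at hd
      exact h hd.1
  · split_ifs with h
    · subst h
      rw [MonoidAlgebra.coeff_mul_single_mul, mul_one]
    · refine MonoidAlgebra.coeff_mul_single_of_forall_mul_ne _ _ fun d hd => ?_
      obtain ⟨a, b, c, rfl⟩ : ∃ a b c, d = FreeMonoid.of a * FreeMonoid.of b * FreeMonoid.of c := by
        have hl := congrArg FreeMonoid.length hd
        simp only [FreeMonoid.length_mul, FreeMonoid.length_of] at hl
        exact FreeMonoid.length_eq_three.1 (by omega)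
      rw [of_mul₄_eq_iff] at hd
      exact h hd.2.2.2

/-- **Rotation invariance from the kernel equation**: if `∑ⱼ ⁅xⱼ, vⱼ⁆ = 0` then
`[pqr] φ(v j) = [jpq] φ(v r)`. [folklore] -/
theorem coeff_cyclic_of_sum_lie_eq_zero (v : Fin n → FreeLieAlgebra ℤ (Fin n))
    (h : ∑ j, ⁅FreeLieAlgebra.of ℤ j, v j⁆ = 0) (j p q r : Fin n) :
    (toTensor ℤ (Fin n) (v j)).coeff (FreeMonoid.of p * FreeMonoid.of q * FreeMonoid.of r) =
      (toTensor ℤ (Fin n) (v r)).coeff (FreeMonoid.of j * FreeMonoid.of p * FreeMonoid.of q) := by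
  have key := congrArg (fun u => (toTensor ℤ (Fin n) u).coeff
    (FreeMonoid.of j * FreeMonoid.of p * FreeMonoid.of q * FreeMonoid.of r)) h
  simp only [coeff_toTensor_sum, coeff_toTensor_zero, coeff_lie_of₄, Finset.sum_sub_distrib,
    Finset.sum_ite_eq', Finset.mem_univ, if_true] at key
  omega

/-! ## Lie constraints on the coefficients of `φ(L₃)` -/

/-- **`L₃` is spanned by the brackets `⁅a,⁅b,c⁆⁆` of letters** (right-normed spanning, twice).
[folklore] -/
theorem wordGrade_three_le_span_lie₃ :
    wordGrade ℤ (FreeLieAlgebra.of ℤ : Fin n → FreeLieAlgebra ℤ (Fin n)) 3 ≤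
      Submodule.span ℤ {v | ∃ a b c : Fin n,
        v = ⁅FreeLieAlgebra.of ℤ a, ⁅FreeLieAlgebra.of ℤ b, FreeLieAlgebra.of ℤ c⁆⁆} := by
  refine (wordGrade_succ_succ_le_span_lie _ 1).trans ?_
  rw [Submodule.span_le]
  rintro _ ⟨x, u, hu, rfl⟩
  have h2 := wordGrade_succ_succ_le_span_lie (R := ℤ)
    (FreeLieAlgebra.of ℤ : Fin n → FreeLieAlgebra ℤ (Fin n)) 0 hu
  refine Submodule.span_induction (p := fun u _ => ⁅FreeLieAlgebra.of ℤ x, u⁆ ∈ _) ?_ ?_ ?_ ?_ h2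
  · rintro _ ⟨y, u', hu', rfl⟩
    rw [wordGrade_one] at hu'
    refine Submodule.span_induction
      (p := fun u' _ => ⁅FreeLieAlgebra.of ℤ x, ⁅FreeLieAlgebra.of ℤ y, u'⁆⁆ ∈ _) ?_ ?_ ?_ ?_ hu'
    · rintro _ ⟨z, rfl⟩
      exact Submodule.subset_span ⟨x, y, z, rfl⟩
    · rw [lie_zero, lie_zero]; exact Submodule.zero_mem _
    · intro a b _ _ ha hb; rw [lie_add, lie_add]; exact add_mem ha hb
    · intro c a _ ha; rw [lie_smul, lie_smul]; exact Submodule.smul_mem _ c ha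
  · rw [lie_zero]; exact Submodule.zero_mem _
  · intro a b _ _ ha hb; rw [lie_add]; exact add_mem ha hb
  · intro c a _ ha; rw [lie_smul]; exact Submodule.smul_mem _ c ha

/-- **Induction principle for `L₃`**: a property closed under `0`, `+` and integer multiples which
holds on the brackets `⁅a,⁅b,c⁆⁆` of letters holds on `L₃`. [folklore] -/
theorem wordGrade_three_induction {P : FreeLieAlgebra ℤ (Fin n) → Prop}
    (hlie : ∀ a b c : Fin n, P ⁅FreeLieAlgebra.of ℤ a, ⁅FreeLieAlgebra.of ℤ b, FreeLieAlgebra.of ℤ c⁆⁆)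
    (hzero : P 0) (hadd : ∀ u v, P u → P v → P (u + v)) (hsmul : ∀ (c : ℤ) u, P u → P (c • u))
    {v : FreeLieAlgebra ℤ (Fin n)}
    (hv : v ∈ wordGrade ℤ (FreeLieAlgebra.of ℤ : Fin n → FreeLieAlgebra ℤ (Fin n)) 3) : P v := by
  refine Submodule.span_induction (p := fun v _ => P v) ?_ hzero (fun u v _ _ => hadd u v)
    (fun c u _ => hsmul c u) (wordGrade_three_le_span_lie₃ hv)
  rintro _ ⟨a, b, c, rfl⟩
  exact hlie a b c

/-- `coeff_lie₃` in product-of-indicators form. [folklore] -/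
theorem coeff_lie₃_prod (a b c p q r : Fin n) :
    (toTensor ℤ (Fin n) ⁅FreeLieAlgebra.of ℤ a, ⁅FreeLieAlgebra.of ℤ b, FreeLieAlgebra.of ℤ c⁆⁆).coeff
      (FreeMonoid.of p * FreeMonoid.of q * FreeMonoid.of r) =
    (if a = p then 1 else 0) * (if b = q then 1 else 0) * (if c = r then 1 else 0) -
      (if a = p then 1 else 0) * (if c = q then 1 else 0) * (if b = r then 1 else 0) -
      (if b = p then 1 else 0) * (if c = q then 1 else 0) * (if a = r then 1 else 0) +
      (if c = p then 1 else 0) * (if b = q then 1 else 0) * (if a = r then 1 else 0) := by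
  rw [coeff_lie₃]
  simp only [ite_zero_mul_ite_zero, mul_one, and_assoc]

/-- **Palindromicity**: for `v ∈ L₃`, `[pqr] φ(v) = [rqp] φ(v)` (the antipode of `ℤ⟨X⟩` is `-1` on
Lie elements and `(-1)^ℓ ·` reversal on words of length `ℓ`). [folklore] -/
theorem coeff_rev_of_mem_three {v : FreeLieAlgebra ℤ (Fin n)}
    (hv : v ∈ wordGrade ℤ (FreeLieAlgebra.of ℤ : Fin n → FreeLieAlgebra ℤ (Fin n)) 3) (p q r : Fin n) :
    (toTensor ℤ (Fin n) v).coeff (FreeMonoid.of p * FreeMonoid.of q * FreeMonoid.of r) =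
      (toTensor ℤ (Fin n) v).coeff (FreeMonoid.of r * FreeMonoid.of q * FreeMonoid.of p) := by
  refine wordGrade_three_induction
    (P := fun v => (toTensor ℤ (Fin n) v).coeff (FreeMonoid.of p * FreeMonoid.of q * FreeMonoid.of r) =
      (toTensor ℤ (Fin n) v).coeff (FreeMonoid.of r * FreeMonoid.of q * FreeMonoid.of p))
    (fun a b c => ?_) ?_ (fun u v hu hv => ?_) (fun c u hu => ?_) hv
  · rw [coeff_lie₃_prod, coeff_lie₃_prod]; ring
  · rw [coeff_toTensor_zero, coeff_toTensor_zero]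
  · rw [coeff_toTensor_add, coeff_toTensor_add, hu, hv]
  · rw [coeff_toTensor_smul, coeff_toTensor_smul, hu]

/-- **Vanishing content sums**: for `v ∈ L₃`, `∑_{σ ∈ S₃} [σ(pqr)] φ(v) = 0` (Lie elements of
degree `≥ 2` die in the commutative quotient `ℤ⟨X⟩ → ℤ[X]`). [folklore] -/
theorem coeff_perm_sum_of_mem_three {v : FreeLieAlgebra ℤ (Fin n)}
    (hv : v ∈ wordGrade ℤ (FreeLieAlgebra.of ℤ : Fin n → FreeLieAlgebra ℤ (Fin n)) 3) (p q r : Fin n) :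
    (toTensor ℤ (Fin n) v).coeff (FreeMonoid.of p * FreeMonoid.of q * FreeMonoid.of r) +
      (toTensor ℤ (Fin n) v).coeff (FreeMonoid.of p * FreeMonoid.of r * FreeMonoid.of q) +
      (toTensor ℤ (Fin n) v).coeff (FreeMonoid.of q * FreeMonoid.of p * FreeMonoid.of r) +
      (toTensor ℤ (Fin n) v).coeff (FreeMonoid.of q * FreeMonoid.of r * FreeMonoid.of p) +
      (toTensor ℤ (Fin n) v).coeff (FreeMonoid.of r * FreeMonoid.of p * FreeMonoid.of q) +
      (toTensor ℤ (Fin n) v).coeff (FreeMonoid.of r * FreeMonoid.of q * FreeMonoid.of p) = 0 := by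
  refine wordGrade_three_induction
    (P := fun v => (toTensor ℤ (Fin n) v).coeff (FreeMonoid.of p * FreeMonoid.of q * FreeMonoid.of r) +
      (toTensor ℤ (Fin n) v).coeff (FreeMonoid.of p * FreeMonoid.of r * FreeMonoid.of q) +
      (toTensor ℤ (Fin n) v).coeff (FreeMonoid.of q * FreeMonoid.of p * FreeMonoid.of r) +
      (toTensor ℤ (Fin n) v).coeff (FreeMonoid.of q * FreeMonoid.of r * FreeMonoid.of p) +
      (toTensor ℤ (Fin n) v).coeff (FreeMonoid.of r * FreeMonoid.of p * FreeMonoid.of q) +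
      (toTensor ℤ (Fin n) v).coeff (FreeMonoid.of r * FreeMonoid.of q * FreeMonoid.of p) = 0)
    (fun a b c => ?_) ?_ (fun u v hu hv => ?_) (fun c u hu => ?_) hv
  · simp only [coeff_lie₃_prod]; ring
  · simp only [coeff_toTensor_zero, add_zero]
  · simp only [coeff_toTensor_add]; linear_combination hu + hv
  · simp only [coeff_toTensor_smul]; linear_combination c * hu

/-- For the unit weight, the weight of a word is its length. [folklore] -/
theorem toAdd_wordWeight_one (w : FreeMonoid (Fin n)) :
    (wordWeight (fun _ => (1 : ℕ)) w).toAdd = w.length := by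
  induction w using FreeMonoid.inductionOn' with
  | one => rw [map_one, FreeMonoid.length_one]; rfl
  | mul_of b a ih => rw [map_mul, toAdd_mul, ih, wordWeight_of, FreeMonoid.length_mul,
      FreeMonoid.length_of]; rfl

/-- **`φ(L₃) ⊆ T₃`**: the coefficients of `φ(v)`, `v ∈ L₃`, vanish off the words of length `3`.
[folklore] -/
theorem coeff_eq_zero_of_length_ne_three {v : FreeLieAlgebra ℤ (Fin n)}
    (hv : v ∈ wordGrade ℤ (FreeLieAlgebra.of ℤ : Fin n → FreeLieAlgebra ℤ (Fin n)) 3)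
    (w : FreeMonoid (Fin n)) (hw : w.length ≠ 3) : (toTensor ℤ (Fin n) v).coeff w = 0 := by
  have hmem := toTensor_mem_tensorGrade ℤ (Fin n) (n := 3) hv
  rw [mem_tensorGrade_iff] at hmem
  by_contra h
  exact hw (by rw [← toAdd_wordWeight_one]; exact hmem w (Finsupp.mem_support_iff.2 h))

/-! ## Small algebra for the kernel verification -/

/-- A bracket of three letters lies in `L₃`. [folklore] -/
theorem lie₃_mem (a b c : Fin n) :
    ⁅FreeLieAlgebra.of ℤ a, ⁅FreeLieAlgebra.of ℤ b, FreeLieAlgebra.of ℤ c⁆⁆ ∈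
      wordGrade ℤ (FreeLieAlgebra.of ℤ : Fin n → FreeLieAlgebra ℤ (Fin n)) 3 := by
  have h3 : (3 : ℕ) = 1 + (1 + 1) := rfl
  rw [h3]
  exact lie_mem_wordGrade (mem_wordGrade_one _ a)
    (lie_mem_wordGrade (mem_wordGrade_one _ b) (mem_wordGrade_one _ c))

/-- A guarded bracket of three letters lies in `L₃`. [folklore] -/
theorem ite_lie₃_mem (P : Prop) [Decidable P] (a b c : Fin n) :
    (if P then ⁅FreeLieAlgebra.of ℤ a, ⁅FreeLieAlgebra.of ℤ b, FreeLieAlgebra.of ℤ c⁆⁆ else 0) ∈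
      wordGrade ℤ (FreeLieAlgebra.of ℤ : Fin n → FreeLieAlgebra ℤ (Fin n)) 3 := by
  split_ifs
  · exact lie₃_mem a b c
  · exact Submodule.zero_mem _

/-- A guarded member of a submodule is a member. [folklore] -/
theorem ite_zero_mem {M : Type*} [AddCommGroup M] [Module ℤ M] (S : Submodule ℤ M) (P : Prop)
    [Decidable P] {v : M} (hv : v ∈ S) : (if P then v else 0) ∈ S := by
  split_ifs
  · exact hv
  · exact Submodule.zero_mem S

/-- `⁅a, if P then v else 0⁆ = if P then ⁅a, v⁆ else 0`. [folklore] -/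
theorem lie_ite_zero {L : Type*} [LieRing L] (a v : L) (P : Prop) [Decidable P] :
    ⁅a, (if P then v else 0)⁆ = if P then ⁅a, v⁆ else 0 := by
  split_ifs
  · rfl
  · exact lie_zero a

/-- **The square/tree relation** `⁅x,⁅y,⁅z,w⁆⁆⁆ - ⁅y,⁅x,⁅z,w⁆⁆⁆ + ⁅z,⁅w,⁅x,y⁆⁆⁆ - ⁅w,⁅z,⁅x,y⁆⁆⁆ = 0`
(Jacobi twice: the left side is `⁅⁅x,y⁆,⁅z,w⁆⁆ + ⁅⁅z,w⁆,⁅x,y⁆⁆`). [folklore] -/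
theorem four_term {L : Type*} [LieRing L] (x y z w : L) :
    ⁅x, ⁅y, ⁅z, w⁆⁆⁆ - ⁅y, ⁅x, ⁅z, w⁆⁆⁆ + ⁅z, ⁅w, ⁅x, y⁆⁆⁆ - ⁅w, ⁅z, ⁅x, y⁆⁆⁆ = 0 := by
  rw [← lie_lie, add_sub_assoc, ← lie_lie, ← lie_skew ⁅x, y⁆ ⁅z, w⁆, neg_add_cancel]

/-- Bookkeeping: `∑ⱼ ⁅xⱼ, ∑_{x,y} f j x y⁆ = 0` if each `∑ⱼ ⁅xⱼ, f j x y⁆ = 0`. [folklore] -/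
theorem sum_lie_sum₂ (f : Fin n → Fin n → Fin n → FreeLieAlgebra ℤ (Fin n))
    (h : ∀ x y, ∑ j, ⁅FreeLieAlgebra.of ℤ j, f j x y⁆ = 0) :
    ∑ j, ⁅FreeLieAlgebra.of ℤ j, ∑ x, ∑ y, f j x y⁆ = 0 := by
  calc ∑ j, ⁅FreeLieAlgebra.of ℤ j, ∑ x, ∑ y, f j x y⁆
      = ∑ j, ∑ x, ∑ y, ⁅FreeLieAlgebra.of ℤ j, f j x y⁆ := by simp only [lie_sum]
    _ = ∑ x, ∑ y, ∑ j, ⁅FreeLieAlgebra.of ℤ j, f j x y⁆ := by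
        rw [Finset.sum_comm]; exact Finset.sum_congr rfl fun x _ => Finset.sum_comm
    _ = 0 := Finset.sum_eq_zero fun x _ => Finset.sum_eq_zero fun y _ => h x y

/-- Bookkeeping: the same with three summation indices. [folklore] -/
theorem sum_lie_sum₃ (f : Fin n → Fin n → Fin n → Fin n → FreeLieAlgebra ℤ (Fin n))
    (h : ∀ x y z, ∑ j, ⁅FreeLieAlgebra.of ℤ j, f j x y z⁆ = 0) :
    ∑ j, ⁅FreeLieAlgebra.of ℤ j, ∑ x, ∑ y, ∑ z, f j x y z⁆ = 0 := by
  calc ∑ j, ⁅FreeLieAlgebra.of ℤ j, ∑ x, ∑ y, ∑ z, f j x y z⁆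
      = ∑ j, ∑ x, ⁅FreeLieAlgebra.of ℤ j, ∑ y, ∑ z, f j x y z⁆ := by simp only [lie_sum]
    _ = ∑ x, ∑ j, ⁅FreeLieAlgebra.of ℤ j, ∑ y, ∑ z, f j x y z⁆ := Finset.sum_comm
    _ = 0 := Finset.sum_eq_zero fun x _ => sum_lie_sum₂ (fun j y z => f j x y z) (h x)

/-- Bookkeeping: the same with four summation indices. [folklore] -/
theorem sum_lie_sum₄ (f : Fin n → Fin n → Fin n → Fin n → Fin n → FreeLieAlgebra ℤ (Fin n))
    (h : ∀ x y z w, ∑ j, ⁅FreeLieAlgebra.of ℤ j, f j x y z w⁆ = 0) :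
    ∑ j, ⁅FreeLieAlgebra.of ℤ j, ∑ x, ∑ y, ∑ z, ∑ w, f j x y z w⁆ = 0 := by
  calc ∑ j, ⁅FreeLieAlgebra.of ℤ j, ∑ x, ∑ y, ∑ z, ∑ w, f j x y z w⁆
      = ∑ j, ∑ x, ⁅FreeLieAlgebra.of ℤ j, ∑ y, ∑ z, ∑ w, f j x y z w⁆ := by simp only [lie_sum]
    _ = ∑ x, ∑ j, ⁅FreeLieAlgebra.of ℤ j, ∑ y, ∑ z, ∑ w, f j x y z w⁆ := Finset.sum_comm
    _ = 0 := Finset.sum_eq_zero fun x _ => sum_lie_sum₃ (fun j y z w => f j x y z w) (h x)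

end DTwoSpan

/-- Helper `helper_dTwoSpanCyclic` (registered sub-goal of stub `stub_dTwoSpan`) · **rotation
invariance from the kernel equation**: for a tuple `v : Fin n → L(ℤⁿ)` with `∑ⱼ ⁅xⱼ, vⱼ⁆ = 0`, the
word coefficients of `φ = toTensor` satisfy `[pqr] φ(v j) = [jpq] φ(v r)`
(`DTwoSpan.coeff_cyclic_of_sum_lie_eq_zero`). [folklore] -/
theorem helper_dTwoSpanCyclic : ∀ (n : ℕ) (v : Fin n → FreeLieAlgebra ℤ (Fin n)), (∑ j, ⁅FreeLieAlgebra.of ℤ j, v j⁆ = 0) → ∀ (j p q r : Fin n), (Literature.Algebra.Lie.toTensor ℤ (Fin n) (v j)).coeff (FreeMonoid.of p * FreeMonoid.of q * FreeMonoid.of r) = (Literature.Algebra.Lie.toTensor ℤ (Fin n) (v r)).coeff (FreeMonoid.of j * FreeMonoid.of p * FreeMonoid.of q) :=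
  fun _ v h => DTwoSpan.coeff_cyclic_of_sum_lie_eq_zero v h

end Summit.SmoothPoincare4.SmoothPoincare4.Theorems.NilpotentShadowsStandard.SaturatedTorsorDescent
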